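import Summits.AtomisticToContinuum.Crystallization.Theorems.SlackRigidity.Negative.WitnessBasics
import Summits.AtomisticToContinuum.Crystallization.Theorems.GscTwinLoopSurgeryLocalLimitStableField
import Summits.AtomisticToContinuum.Crystallization.Theorems.GscTwinLoopSurgeryLocalLimitStable
import Literature.MathematicalPhysics.StatisticalMechanics.HardCoreGSC
import Literature.Probability.Process.LocallyMatches
import HarnessLib

/-!
# Line `ekeland-surgery-parity` (crux `SlackRigidity`, stmt-AtomisticToContinuum-11960): local
# limits of `λ_k → 0` quasi-ground-states are hard-core GSCs

Stub `stub_localLimitGSC` of the line skeleton — the `λ_k → 0` analogue of the tree theorem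
`LocalLimitStable.isHardCoreGSC_of_isLocalLimitOfGroundStates` (item 14086; Sütő 2011 §7
Definition 7.1, distinct-points convention): if uniformly `δ`-separated `λ_k`-QUASI-ground-states
`y k` (no injective relocation `z` lowers the energy by more than `λ_k · #{i : z i ≠ y k i}`),
recentred at arbitrary `c k`, are two-way locally matched with `S` on every ball, then
`IsHardCoreGSC lennardJones S`.  How: (1) the quasi inequality is invariant under recentring
(`llgsc_quasi_translate`) and the limit set is `δ`-separated (`llgsc_le_dist_of_matched`);
(2) a `λ`-quasi-ground-state satisfies the hard-core GSC exchange inequality of its own point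
set UP TO `|λ| · n` (`llgsc_quasi_exchange_le`: the competitor `(X ∖ y) ∪ z` of
`IsGroundState.isHardCoreGSC_range` differs from `x` in at most `n` labels); (3) the
transplant-and-limit argument of the tree theorem verbatim (`llgsc_isHardCoreGSC_of_quasi`:
matched particles, rests two-way matched with `S ∖ y`, energies converge by continuity of `V_LJ`
off `0`, fields by `LocalLimitStable.tendsto_sum_lennardJones_of_matched`, `|λ_k| · n → 0`).
All `[folklore]` (Radin 1987 / Bellissard–Radin–Shlosman 2010; Sütő 2011 §7).
-/

noncomputable section

open scoped BigOperators Topology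
open Filter Set Metric
open Literature.MathematicalPhysics.StatisticalMechanics
open Literature.Probability.Process
open Summit.AtomisticToContinuum.Crystallization.Theorems.SlackRigidityNegative (E3)

namespace Summit.AtomisticToContinuum.Crystallization.Theorems.EkelandLocalLimitGSC

open Summit.AtomisticToContinuum.Crystallization.Theorems.LocalLimitStable
  (norm_le_dist_add_norm exists_pos_le_dist_of_not_mem tendsto_sum_lennardJones_of_matched)

/-- **Recentring a quasi-ground-state.** If no injective relocation `z` of `x` lowers the energy
by more than `λ · #{i : z i ≠ x i}`, the same holds for the recentred configuration `x - c`
(translate the competitor back by `+ c`: energies and Hamming distances agree). [folklore] -/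
theorem llgsc_quasi_translate {N : ℕ} {lam : ℝ} {x : Fin N → E3} (c : E3)
    (hq : ∀ z : Fin N → E3, Function.Injective z →
      interactionEnergy lennardJones x -
          lam * ((Finset.univ.filter fun i => z i ≠ x i).card : ℝ) ≤
        interactionEnergy lennardJones z) :
    ∀ z : Fin N → E3, Function.Injective z →
      interactionEnergy lennardJones (fun i => x i - c) -
          lam * ((Finset.univ.filter fun i => z i ≠ x i - c).card : ℝ) ≤
        interactionEnergy lennardJones z := by
  intro z hz
  have hz' : Function.Injective (fun i => z i + c) := fun i j h => hz (add_right_cancel h)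
  have h := hq (fun i => z i + c) hz'
  have hfilter : (Finset.univ.filter fun i => z i + c ≠ x i) =
      (Finset.univ.filter fun i => z i ≠ x i - c) :=
    Finset.filter_congr fun i _ => by rw [ne_eq, ne_eq, ← eq_sub_iff_add_eq]
  rw [interactionEnergy_add_const, hfilter] at h
  rwa [interactionEnergy_sub_const]

/-- **Quasi-ground-states are hard-core GSCs of their point set up to `|λ| · n`.** If no
injective `z'` has `𝓔(z') < 𝓔(x) − λ · #{j : z' j ≠ x j}` (`x` injective, `X = range x`), then
exchanging `n` of its points `y` for `n` distinct new points `z` off `X ∖ y` gives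
`𝓔(y) + I(y, X ∖ y) ≤ 𝓔(z) + I(z, X ∖ y) + |λ| · n`: the competitor `(X ∖ y) ∪ z`
(`Function.extend e z x`) differs from `x` in at most `n` labels, and the energies are compared
by `two_mul_interactionEnergy_exchange` as in `IsGroundState.isHardCoreGSC_range`. [folklore] -/
theorem llgsc_quasi_exchange_le {N : ℕ} {lam : ℝ} {x : Fin N → E3} (hx : Function.Injective x)
    (hq : ∀ z : Fin N → E3, Function.Injective z →
      interactionEnergy lennardJones x -
          lam * ((Finset.univ.filter fun i => z i ≠ x i).card : ℝ) ≤
        interactionEnergy lennardJones z)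
    {n : ℕ} {y z : Fin n → E3} (hy : Function.Injective y) (hz : Function.Injective z)
    (hyX : Set.range y ⊆ Set.range x)
    (hdisj : Disjoint (Set.range z) (Set.range x \ Set.range y)) :
    interactionEnergy lennardJones y +
        ∑ i, ∑' q : ↥(Set.range x \ Set.range y), lennardJones (dist (y i) q) ≤
      interactionEnergy lennardJones z +
        ∑ i, ∑' q : ↥(Set.range x \ Set.range y), lennardJones (dist (z i) q) + |lam| * n := by
  classical
  choose e he using fun i => hyX (Set.mem_range_self (f := y) i)
  have hei : Function.Injective e := fun i j h => hy (by rw [← he i, ← he j, h])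
  have hnot : ∀ j, j ∉ Finset.univ.map ⟨e, hei⟩ → ¬∃ a, e a = j := fun j hj ⟨a, ha⟩ =>
    hj (Finset.mem_map.2 ⟨a, Finset.mem_univ a, ha⟩)
  have hoffmem : ∀ j, (¬∃ a, e a = j) → x j ∈ Set.range x \ Set.range y := fun j hj =>
    ⟨Set.mem_range_self j, fun ⟨i, hi⟩ => hj ⟨i, hx ((he i).trans hi)⟩⟩
  -- the remaining particles are those with indices off `e(Fin n)`
  have hrest : Set.range x \ Set.range y = x '' ↑((Finset.univ.map ⟨e, hei⟩)ᶜ) := by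
    ext q
    constructor
    · rintro ⟨⟨j, rfl⟩, hq⟩
      refine ⟨j, ?_, rfl⟩
      rw [Finset.coe_compl, Set.mem_compl_iff, Finset.mem_coe]
      intro hjT
      obtain ⟨a, -, ha⟩ := Finset.mem_map.1 hjT
      exact hq ⟨a, by rw [← he a]; exact congrArg x ha⟩
    · rintro ⟨j, hj, rfl⟩
      rw [Finset.coe_compl, Set.mem_compl_iff, Finset.mem_coe] at hj
      exact hoffmem j (hnot j hj)
  -- the competitor: `z` on the indices `e(Fin n)`, `x` elsewhere; it consists of distinct points
  have hinj' : Function.Injective (Function.extend e z x) := by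
    intro j₁ j₂ hj
    by_cases h₁ : ∃ a, e a = j₁ <;> by_cases h₂ : ∃ a, e a = j₂
    · obtain ⟨a, rfl⟩ := h₁
      obtain ⟨b, rfl⟩ := h₂
      rw [hei.extend_apply, hei.extend_apply] at hj
      rw [hz hj]
    · obtain ⟨a, rfl⟩ := h₁
      rw [hei.extend_apply, Function.extend_apply' _ _ _ h₂] at hj
      have hza : z a ∈ Set.range x \ Set.range y := by rw [hj]; exact hoffmem j₂ h₂
      exact absurd hza (Set.disjoint_left.1 hdisj (Set.mem_range_self a))
    · obtain ⟨b, rfl⟩ := h₂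
      rw [Function.extend_apply' _ _ _ h₁, hei.extend_apply] at hj
      have hzb : z b ∈ Set.range x \ Set.range y := by rw [← hj]; exact hoffmem j₁ h₁
      exact absurd hzb (Set.disjoint_left.1 hdisj (Set.mem_range_self b))
    · rw [Function.extend_apply' _ _ _ h₁, Function.extend_apply' _ _ _ h₂] at hj
      exact hx hj
  have hcard : ((Finset.univ.filter fun j => Function.extend e z x j ≠ x j).card : ℝ) ≤ n := by
    have hsub : (Finset.univ.filter fun j => Function.extend e z x j ≠ x j) ⊆
        Finset.univ.map ⟨e, hei⟩ := fun j hj => by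
      by_contra hjT
      exact (Finset.mem_filter.1 hj).2 (Function.extend_apply' z x j (hnot j hjT))
    simpa using Finset.card_le_card hsub
  have hmin : interactionEnergy lennardJones x - |lam| * n ≤
      interactionEnergy lennardJones (Function.extend e z x) := by
    have h := hq _ hinj'
    have h2 : lam * ((Finset.univ.filter fun j => Function.extend e z x j ≠ x j).card : ℝ) ≤
        |lam| * n := (mul_le_mul_of_nonneg_right (le_abs_self lam) (Nat.cast_nonneg _)).trans
      (mul_le_mul_of_nonneg_left hcard (abs_nonneg lam))
    linarith
  have h1 := two_mul_interactionEnergy_exchange lennardJones x x y ⟨e, hei⟩ he (fun j _ => rfl)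
  have h2 := two_mul_interactionEnergy_exchange lennardJones x (Function.extend e z x) z ⟨e, hei⟩
    (fun a => hei.extend_apply z x a) (fun j hj => Function.extend_apply' z x j (hnot j hj))
  have hfield : ∀ w : Fin n → E3,
      ∑ i, ∑' q : ↥(Set.range x \ Set.range y), lennardJones (dist (w i) q) =
        ∑ i, ∑ j ∈ (Finset.univ.map ⟨e, hei⟩)ᶜ, lennardJones (dist (w i) (x j)) := by
    intro w
    refine Finset.sum_congr rfl fun i _ => ?_
    rw [tsum_congr_set_coe (fun q => lennardJones (dist (w i) q)) hrest,
      tsum_image (fun q => lennardJones (dist (w i) q)) hx.injOn,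
      Finset.tsum_subtype' _ (fun j => lennardJones (dist (w i) (x j)))]
  rw [hfield y, hfield z]
  linarith [hmin, h1, h2]

/-- **Local limits of `δ`-separated configurations are `δ`-separated**: for a tolerance
`ε₁ < dist p q / 2` the partners of `p ≠ q ∈ X` in some `W j` are distinct particles, `≥ δ`
apart and within `ε₁` of `p`, `q`. [folklore] -/
theorem llgsc_le_dist_of_matched {δ : ℝ} {nn : ℕ → ℕ} (W : (j : ℕ) → Fin (nn j) → E3)
    (hWsep : ∀ j (i i' : Fin (nn j)), i ≠ i' → δ ≤ dist (W j i) (W j i')) {X : Set E3}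
    (hmatch : ∀ R ε : ℝ, 0 < ε → ∀ᶠ j : ℕ in atTop, LocallyMatches R ε (Set.range (W j)) X) :
    ∀ p ∈ X, ∀ q ∈ X, p ≠ q → δ ≤ dist p q := by
  intro p hp q hq hpq
  have hd : 0 < dist p q := dist_pos.2 hpq
  refine le_of_forall_pos_le_add fun ε hε => ?_
  have hε₁ε := min_le_left (ε / 2) (dist p q / 4)
  have hε₁d := min_le_right (ε / 2) (dist p q / 4)
  obtain ⟨j, hj⟩ := (hmatch (max ‖p‖ ‖q‖) (min (ε / 2) (dist p q / 4))
    (lt_min (by positivity) (by positivity))).exists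
  obtain ⟨_, ⟨i, rfl⟩, hip⟩ := hj.1 p hp (le_max_left _ _)
  obtain ⟨_, ⟨i', rfl⟩, hi'q⟩ := hj.1 q hq (le_max_right _ _)
  have hii' : i ≠ i' := by
    rintro rfl
    linarith [dist_triangle_left p q (W j i)]
  have h2 := dist_triangle4 (W j i) p q (W j i')
  rw [dist_comm q (W j i')] at h2
  linarith [hWsep j i i' hii']

/-- **Local limits of `λ_j → 0` quasi-ground-states are hard-core GSCs** (the `λ`-robust form of
`LocalLimitStable.isHardCoreGSC_of_isLocalLimitOfGroundStates`, same transplant argument): for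
`n` points `y` of `X` and new positions `z` off `X ∖ y`, the particles `y'_j` of `W j` within
`δ/2` of `y` are eventually injective, `z` avoids the rest `W j ∖ y'_j`, the rests are two-way
matched with `X ∖ y`, and the exchange inequality of `W j` under `y'_j ↦ z` — valid up to
`|λ_j| · n` (`llgsc_quasi_exchange_le`) — passes to the limit (`𝓔(y'_j) → 𝓔(y)`, fields by
`LocalLimitStable.tendsto_sum_lennardJones_of_matched`, `|λ_j| · n → 0`). [folklore] -/
theorem llgsc_isHardCoreGSC_of_quasi {δ : ℝ} (hδ : 0 < δ) {nn : ℕ → ℕ}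
    {W : (j : ℕ) → Fin (nn j) → E3} {lam : ℕ → ℝ}
    (hWq : ∀ (j : ℕ) (z : Fin (nn j) → E3), Function.Injective z →
      interactionEnergy lennardJones (W j) -
          lam j * ((Finset.univ.filter fun i => z i ≠ W j i).card : ℝ) ≤
        interactionEnergy lennardJones z)
    (hlam : Tendsto lam atTop (𝓝 0))
    (hWsep : ∀ j (i i' : Fin (nn j)), i ≠ i' → δ ≤ dist (W j i) (W j i')) {X : Set E3}
    (hmatch : ∀ R ε : ℝ, 0 < ε → ∀ᶠ j : ℕ in atTop, LocallyMatches R ε (Set.range (W j)) X) :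
    IsHardCoreGSC lennardJones X := by
  classical
  have hXsep : ∀ p ∈ X, ∀ q ∈ X, p ≠ q → δ ≤ dist p q := llgsc_le_dist_of_matched W hWsep hmatch
  have hWinj : ∀ j, Function.Injective (W j) := fun j i i' h => by_contra fun hne =>
    (hδ.trans_le (hWsep j i i' hne)).ne' (by rw [h, dist_self])
  intro n y z hy hz hyX hdisj
  -- the matched particles `y' j i`: the particle of `W j` within `δ/2` of `y i`, if any
  have hpick : ∀ (j : ℕ) (i : Fin n), ∃ q : E3, (∃ k, dist (W j k) (y i) < δ / 2) →
      q ∈ Set.range (W j) ∧ dist q (y i) < δ / 2 := fun j i => by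
    by_cases h : ∃ k, dist (W j k) (y i) < δ / 2
    · obtain ⟨k, hk⟩ := h
      exact ⟨W j k, fun _ => ⟨Set.mem_range_self k, hk⟩⟩
    · exact ⟨y i, fun h' => absurd h' h⟩
  choose y' hy' using hpick
  have hy'ε : ∀ (j : ℕ) (i : Fin n) (ε : ℝ), ε < δ / 2 → (∃ k, dist (W j k) (y i) ≤ ε) →
      y' j i ∈ Set.range (W j) ∧ dist (y' j i) (y i) ≤ ε := by
    intro j i ε hε hk
    obtain ⟨k, hk⟩ := hk
    obtain ⟨hmem, hlt⟩ := hy' j i ⟨k, hk.trans_lt hε⟩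
    refine ⟨hmem, ?_⟩
    obtain ⟨k', hk'⟩ := hmem
    by_contra hne
    have hkk : k' ≠ k := fun h => hne (by rw [← hk', h]; exact hk)
    have h1 := hWsep j k' k hkk
    have h2 := dist_triangle_right (W j k') (W j k) (y i)
    rw [hk'] at h1 h2
    linarith
  -- the rests `S j = W j ∖ y' j`
  set S : ℕ → Finset E3 := fun j => Finset.univ.image (W j) \ Finset.univ.image (y' j) with hS
  have hSmem : ∀ j p, p ∈ S j ↔ (∃ k, W j k = p) ∧ ¬ ∃ i, y' j i = p := fun j p => by
    simp only [hS, Finset.mem_sdiff, Finset.mem_image, Finset.mem_univ, true_and]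
  have hScoe : ∀ j, (↑(S j) : Set E3) = Set.range (W j) \ Set.range (y' j) := fun j => by
    ext p
    simp only [Finset.mem_coe, hSmem, Set.mem_sdiff, Set.mem_range]
  have hSsep : ∀ j, ∀ p ∈ S j, ∀ q ∈ S j, p ≠ q → δ ≤ dist p q := by
    intro j p hp q hq hpq
    obtain ⟨⟨k, rfl⟩, -⟩ := (hSmem j p).1 hp
    obtain ⟨⟨l, rfl⟩, -⟩ := (hSmem j _).1 hq
    exact hWsep j k l fun h => hpq (h ▸ rfl)
  -- (ev1) eventually every `y i` is matched
  set Ry : ℝ := ∑ k, ‖y k‖ with hRy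
  have hyR : ∀ i, ‖y i‖ ≤ Ry := fun i =>
    Finset.single_le_sum (f := fun k => ‖y k‖) (fun _ _ => norm_nonneg _) (Finset.mem_univ i)
  have ev1 : ∀ ε : ℝ, 0 < ε → ε < δ / 2 → ∀ᶠ j in atTop, ∀ i,
      y' j i ∈ Set.range (W j) ∧ dist (y' j i) (y i) ≤ ε := by
    intro ε hε hεδ
    filter_upwards [hmatch Ry ε hε] with j hj i
    obtain ⟨_, ⟨k, rfl⟩, hk⟩ := hj.1 (y i) (hyX (Set.mem_range_self i)) (hyR i)
    exact hy'ε j i ε hεδ ⟨k, hk⟩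
  have hδ4 : (0 : ℝ) < δ / 4 := by positivity
  have hδ42 : δ / 4 < δ / 2 := by linarith
  -- (ev2) eventually `y' j` is injective
  have ev2 : ∀ᶠ j in atTop, Function.Injective (y' j) := by
    filter_upwards [ev1 (δ / 4) hδ4 hδ42] with j hj
    intro i i' hii'
    by_contra hne
    have h1 := hXsep _ (hyX (Set.mem_range_self i)) _ (hyX (Set.mem_range_self i'))
      (fun h => hne (hy h))
    have h2 := dist_triangle (y i) (y' j i) (y i')
    have hi := (hj i).2
    rw [hii'] at hi h2
    rw [dist_comm] at hi
    linarith [(hj i').2]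
  -- (ev3) eventually the matched particles are particles
  have ev3 : ∀ᶠ j in atTop, Set.range (y' j) ⊆ Set.range (W j) := by
    filter_upwards [ev1 (δ / 4) hδ4 hδ42] with j hj
    rintro _ ⟨i, rfl⟩
    exact (hj i).1
  -- (ev4) eventually the new positions avoid the rest
  have ev4 : ∀ᶠ j in atTop, Disjoint (Set.range z) (Set.range (W j) \ Set.range (y' j)) := by
    have key : ∀ i, ∀ᶠ j in atTop, z i ∉ Set.range (W j) \ Set.range (y' j) := by
      intro i
      by_cases hzi : z i ∈ Set.range y
      · obtain ⟨i₀, hi₀⟩ := hzi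
        filter_upwards [ev1 (δ / 4) hδ4 hδ42] with j hj
        rintro ⟨⟨k, hk⟩, hnot⟩
        obtain ⟨⟨k', hk'⟩, hyi⟩ := hj i₀
        refine hnot ⟨i₀, ?_⟩
        by_contra hne
        have hkk : k' ≠ k := fun h => hne (by rw [← hk', h, hk])
        have h1 := hWsep j k' k hkk
        rw [hk', hk] at h1
        rw [hi₀] at hyi
        linarith
      · have hzX : z i ∉ X := fun h =>
          (Set.disjoint_left.1 hdisj (Set.mem_range_self i)) ⟨h, hzi⟩
        obtain ⟨ρ₀, hρ₀, hρ⟩ := exists_pos_le_dist_of_not_mem hδ hXsep hzX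
        filter_upwards [hmatch ‖z i‖ (ρ₀ / 2) (by positivity)] with j hj
        rintro ⟨⟨k, hk⟩, -⟩
        obtain ⟨p, hpX, hkp⟩ := hj.2 (W j k) (Set.mem_range_self k) (by rw [hk])
        have := hρ p hpX
        rw [← hk] at this
        linarith
    filter_upwards [Filter.eventually_all.2 key] with j hj
    exact Set.disjoint_left.2 (by rintro _ ⟨i, rfl⟩ hq; exact hj i hq)
  -- (ev5) eventually the rests are two-way matched with `X ∖ y` about any centre
  have ev5 : ∀ (w₀ : E3) (R ε : ℝ), 0 < ε → ∀ᶠ j in atTop,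
      (∀ p ∈ X \ Set.range y, dist p w₀ ≤ R → ∃ q ∈ S j, dist q p ≤ ε) ∧
        (∀ q ∈ S j, dist q w₀ ≤ R → ∃ p ∈ X \ Set.range y, dist q p ≤ ε) := by
    intro w₀ R ε hε
    set ε₁ : ℝ := min ε (δ / 4) with hε₁
    have hε₁0 : 0 < ε₁ := lt_min hε hδ4
    have hε₁ε : ε₁ ≤ ε := min_le_left _ _
    have hε₁δ : ε₁ ≤ δ / 4 := min_le_right _ _
    filter_upwards [hmatch (R + ‖w₀‖) ε₁ hε₁0, ev1 ε₁ hε₁0 (hε₁δ.trans_lt hδ42)] with j hj hj1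
    obtain ⟨hA, hB⟩ := hj
    constructor
    · rintro p ⟨hpX, hpy⟩ hpR
      obtain ⟨_, ⟨k, rfl⟩, hk⟩ := hA p hpX (by linarith [norm_le_dist_add_norm p w₀])
      refine ⟨W j k, (hSmem j _).2 ⟨⟨k, rfl⟩, ?_⟩, hk.trans hε₁ε⟩
      rintro ⟨i, hi⟩
      obtain ⟨-, hyi⟩ := hj1 i
      have hne : y i ≠ p := fun h => hpy ⟨i, h⟩
      have h1 := hXsep _ (hyX (Set.mem_range_self i)) _ hpX hne
      have h2 := dist_triangle (y i) (y' j i) p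
      rw [hi] at hyi h2
      rw [dist_comm] at hyi
      have h3 : dist (W j k) p ≤ ε₁ := hk
      linarith
    · intro q hq hqR
      obtain ⟨⟨k, rfl⟩, hqy⟩ := (hSmem j q).1 hq
      obtain ⟨p, hpX, hkp⟩ := hB (W j k) (Set.mem_range_self k)
        (by linarith [norm_le_dist_add_norm (W j k) w₀])
      refine ⟨p, ⟨hpX, ?_⟩, hkp.trans hε₁ε⟩
      rintro ⟨i, rfl⟩
      obtain ⟨⟨k', hk'⟩, hyi⟩ := hj1 i
      refine hqy ⟨i, ?_⟩
      by_contra hne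
      have hkk : k' ≠ k := fun h => hne (by rw [← hk', h])
      have h1 := hWsep j k' k hkk
      rw [hk'] at h1
      have h2 := dist_triangle (y' j i) (y i) (W j k)
      rw [dist_comm (y i) (W j k)] at h2
      have h3 : dist (W j k) (y i) ≤ ε₁ := hkp
      linarith
  -- (ev6) eventually: the exchange inequality of `W j` under `y' j ↦ z`, up to `|λ_j| · n`
  have ev6 : ∀ᶠ j in atTop,
      interactionEnergy lennardJones (y' j) + ∑ i, ∑ q ∈ S j, lennardJones (dist (y' j i) q) ≤
        interactionEnergy lennardJones z + ∑ i, ∑ q ∈ S j, lennardJones (dist (z i) q) +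
          |lam j| * n := by
    filter_upwards [ev2, ev3, ev4] with j h2 h3 h4
    have key := llgsc_quasi_exchange_le (hWinj j) (hWq j) h2 hz h3 h4
    have hconv : ∀ w : E3, ∑' q : ↥(Set.range (W j) \ Set.range (y' j)),
        lennardJones (dist w q) = ∑ q ∈ S j, lennardJones (dist w q) := fun w => by
      rw [tsum_congr_set_coe (fun q => lennardJones (dist w q)) (hScoe j).symm,
        Finset.tsum_subtype' (S j) (fun q => lennardJones (dist w q))]
    simpa only [hconv] using key
  -- (E7) the limits
  have limy' : ∀ i, Tendsto (fun j => y' j i) atTop (𝓝 (y i)) := by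
    intro i
    rw [Metric.tendsto_nhds]
    intro ε hε
    have hε' : 0 < min (ε / 2) (δ / 4) := lt_min (by positivity) hδ4
    filter_upwards [ev1 (min (ε / 2) (δ / 4)) hε' ((min_le_right _ _).trans_lt hδ42)]
      with j hj
    linarith [(hj i).2, min_le_left (ε / 2) (δ / 4)]
  have limE : Tendsto (fun j => interactionEnergy lennardJones (y' j)) atTop
      (𝓝 (interactionEnergy lennardJones y)) := by
    unfold interactionEnergy
    refine tendsto_finsetSum _ fun i _ => tendsto_finsetSum _ fun k hk => ?_
    have hik : i ≠ k := (Finset.mem_Ioi.1 hk).ne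
    have hne : dist (y i) (y k) ∈ ({0}ᶜ : Set ℝ) := dist_ne_zero.2 fun h => hik (hy h)
    have hcont : ContinuousAt lennardJones (dist (y i) (y k)) :=
      continuousOn_lennardJones.continuousAt (isOpen_compl_singleton.mem_nhds hne)
    exact hcont.tendsto.comp ((limy' i).dist (limy' k))
  have hX'sep : ∀ p ∈ X \ Set.range y, ∀ q ∈ X \ Set.range y, p ≠ q → δ ≤ dist p q :=
    fun p hp q hq hpq => hXsep p hp.1 q hq.1 hpq
  have limFy : ∀ i, Tendsto (fun j => ∑ q ∈ S j, lennardJones (dist (y' j i) q)) atTop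
      (𝓝 (∑' q : ↥(X \ Set.range y), lennardJones (dist (y i) q))) := fun i =>
    tendsto_sum_lennardJones_of_matched hδ hX'sep hδ
      (fun q hq => hXsep _ (hyX (Set.mem_range_self i)) _ hq.1 fun h => hq.2 ⟨i, h⟩)
      hSsep (limy' i) (ev5 (y i))
  have limFz : ∀ i, Tendsto (fun j => ∑ q ∈ S j, lennardJones (dist (z i) q)) atTop
      (𝓝 (∑' q : ↥(X \ Set.range y), lennardJones (dist (z i) q))) := fun i => by
    obtain ⟨ρ₀, hρ₀, hρ⟩ := exists_pos_le_dist_of_not_mem hδ hX'sep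
      (Set.disjoint_left.1 hdisj (Set.mem_range_self i))
    exact tendsto_sum_lennardJones_of_matched hδ hX'sep hρ₀ hρ hSsep tendsto_const_nhds
      (ev5 (z i))
  have limlam : Tendsto (fun j => |lam j| * (n : ℝ)) atTop (𝓝 0) := by
    simpa only [abs_zero, zero_mul] using hlam.abs.mul_const (n : ℝ)
  have key := le_of_tendsto_of_tendsto (limE.add (tendsto_finsetSum _ fun i _ => limFy i))
    ((tendsto_const_nhds.add (tendsto_finsetSum _ fun i _ => limFz i)).add limlam) ev6
  simpa only [add_zero] using key

/-- **Stub `stub_localLimitGSC` — local limits of `λ_k → 0` quasi-ground-states are hard-core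
GSCs** (the `λ`-robust form of item 14086 `LocalLimitStable`; Sütő 2011 §7 Definition 7.1,
distinct-points convention): if the injective `y k` are uniformly `δ`-separated
`λ_k`-quasi-ground-states of the Lennard-Jones energy with `λ_k → 0` and the recentred point sets
`{y k i − c k}` are eventually two-way matched with `S` on every ball, then `S` is a hard-core
canonical GSC: recentre (`llgsc_quasi_translate`), transplant (`llgsc_isHardCoreGSC_of_quasi`).
[folklore] -/
theorem stub_localLimitGSC :
    ∀ δ : ℝ, 0 < δ → ∀ (n : ℕ → ℕ) (y : (k : ℕ) → (Fin (n k) → E3)) (c : ℕ → E3) (lam : ℕ → ℝ),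
    (∀ k, Function.Injective (y k) ∧ ∀ z : Fin (n k) → E3, Function.Injective z →
      interactionEnergy lennardJones (y k) -
          lam k * ((Finset.univ.filter fun i => z i ≠ y k i).card : ℝ) ≤
        interactionEnergy lennardJones z) →
    Tendsto lam atTop (𝓝 0) →
    (∀ k (i j : Fin (n k)), i ≠ j → δ ≤ dist (y k i) (y k j)) →
    ∀ S : Set E3,
      (∀ R ε : ℝ, 0 < ε → ∀ᶠ k : ℕ in atTop,
        LocallyMatches R ε (Set.range fun i : Fin (n k) => y k i - c k) S) →
      IsHardCoreGSC lennardJones S := by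
  intro δ hδ n y c lam hq hlam hsep S hmatch
  refine llgsc_isHardCoreGSC_of_quasi hδ (W := fun k i => y k i - c k)
    (fun k => llgsc_quasi_translate (c k) (hq k).2) hlam (fun k i j hij => ?_) hmatch
  rw [dist_sub_right]
  exact hsep k i j hij

end Summit.AtomisticToContinuum.Crystallization.Theorems.EkelandLocalLimitGSC

end
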